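import Summits.RiemannHypothesis.RiemannHypothesis.Theorems.PfPersistenceAMPOddLevelWall
import HarnessLib

/-!
# PF persistence (pf seat, gen 4) — THE SATURATION LAW OF THE AMP MARGIN: `t* = WALL/(1 + μ)`

Unit `pub-rhpf-pf-g4` of the `pub-rhpf` cell (mechanism / rigidity campaign; **no RH claims**).
Helper file in support of the cell's target item `EvenOneSignedWindows`; nothing here is a statement about `ζ`.

`PfPersistenceAMPOddLevelWall` (84b7c0be121b) proved, from the Galerkin intertwining hypothesis (G)
(`GalerkinIntertwining`: `Q⁺D − DQ⁻ = 2 δ_a ρᵀ`, `Q⁺ = A₀ + β|c⟩⟨c|`), the PAIRING IDENTITY at an odd level and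
the WALL `t* ≤ (ε₁⁻ − ε₁⁺)/(E₁ − ε₁⁺)` on the AMP margin, and recorded that the measured threshold SATURATES the
wall at `97.8 %` (ζ, `N = 100`, `a = 0.55 … 1.20`).  This file explains the `2 %`: it is an exact identity with
ONE new parameter `μ`.

**§1 Three exact identities (PROVED, abstract real inner-product spaces, `A₀` symmetric).**
* `secular_diff` — the RESOLVENT IDENTITY for the secular function `f(s) = 1 + β⟪c, x(s)⟫`,
  `x(s) = (A₀ − s)⁻¹c`:  `⟪c, x(s₂)⟫ − ⟪c, x(s₁)⟫ = (s₂ − s₁)⟪x(s₁), x(s₂)⟫`.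
* `secular_eq_evenOverlap` — at an even eigenpair `A₀u + β⟪c,u⟫c = ε⁺u` with `p = ⟪c, u⟫`:
  `p·(1 + β⟪c, x(s)⟫) = (ε⁺ − s)⟪u, x(s)⟫` for every AMP vector `x(s)` (so `f(ε⁺) = 0` when `p ≠ 0`, and the
  even ground state IS the AMP vector at its own level: `A₀u − ε⁺u = −βp·c`, `ampVector_at_evenLevel`).
* `intertwining_pairing_offlevel` — (G) paired with `x(s)` at ANY level `s`:
  `2ρ(ψ)⟪δ_a, x(s)⟫ = ⟪c, Dψ⟫(1 + β⟪c, x(s)⟫) + (s − e)⟪Dψ, x(s)⟫` for every odd eigenpair `Q⁻ψ = eψ`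
  (the wall file's `intertwining_pairing` is the case `s = e`).

**§2 The edge-zero law (PROVED).**  Multiplying the third identity by `p` and inserting the second:
`2pρ(ψ)·⟪δ_a, x(s)⟫ = (ε⁺ − s)⟪u, x(s)⟫⟪c, Dψ⟫ + p(s − e)⟪Dψ, x(s)⟫`  (`edge_value_master`).  Hence at an
EDGE ZERO `⟪δ_a, x(s)⟫ = 0` of the AMP family (`edgeZero_weightedMean`):

`(1 + μ)·s = e + μ·ε⁺`,  `μ := −⟪u, x(s)⟫⟪c, Dψ⟫ / (p⟪Dψ, x(s)⟫)`,

i.e. `s` is the `μ`-WEIGHTED MEAN of the odd level `e = ε₁⁻` and the even level `ε⁺ = ε₁⁺`; for `μ > 0` and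
`ε₁⁺ < ε₁⁻` it lies strictly between them (`edgeZero_mem_Ioo`), with
`(s − ε₁⁺)/(ε₁⁻ − ε₁⁺) = 1/(1 + μ)` (`edgeZero_saturation`) and `ε₁⁻ − s = μ(ε₁⁻ − ε₁⁺)/(1 + μ)`
(`edgeZero_deficit`).  If the AMP threshold `s*` is such an edge zero (the EDGE CHANNEL, pf gens 2–3), then
`t* = ampMargin = WALL/(1 + μ)` exactly (`ampMargin_eq_wall_div`), WALL `= (ε₁⁻ − ε₁⁺)/(E₁ − ε₁⁺)`.

**§3 The geometric value of μ (PROVED + DATA).**  At `s = ε₁⁺` the AMP vector is `−u/(βp)`, so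
`μ(ε₁⁺) = μ_geom := −‖u‖²⟪c, Dψ₁⟫/(p⟪u, Dψ₁⟫)` (`mu_at_evenLevel`), a MACROSCOPIC invariant of the window (polar
vector, even ground state, derivative of the odd ground state; no tiny level enters), positive as soon as
`⟪c, Dψ₁⟫ < 0 < p` and `⟪u, Dψ₁⟫ > 0` (`muGeom_pos`) — and the last sign is itself a consequence of (G):
`(ε₁⁺ − ε₁⁻)⟪u, Dψ₁⟫ = 2ρ(ψ₁)⟪δ_a, u⟫` (`intertwining_pairing_even_eigen`), so `ρ(ψ₁) < 0 < ⟪δ_a, u⟫` and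
`ε₁⁺ < ε₁⁻` give `⟪u, Dψ₁⟫ > 0` (`inner_evenEigen_deriv_pos`).  Since `x(s*) = x(ε₁⁺)(1 + O(t*))`,
`μ(s*) = μ_geom(1 + O(t*))`.

DATA (ζ, `N = 100`, 80-digit arithmetic on fake-6's 56-digit sector blocks; `a = 1.00`): every identity of §1–§2
holds to relative `1e-29 … 1e-53`; `u = −2p·x(ε₁⁺)` to `1.5e-58`; `μ(s*) = (ε₁⁻ − s*)/(s* − ε₁⁺) = 2.18381e-2`,
`μ_geom = 2.18525e-2` (relative deviation `6.6e-4`), `t*/WALL = 0.978629 = 1/(1 + μ(s*))`.  Over the 14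
windows `a = 0.55, 0.60, …, 1.20`: `μ_geom` increases monotonically from `1.740e-2` to `2.275e-2`,
`μ(s*) = μ_geom(1 − η)` with `η` from `1.1e-2` down to `3.2e-4` (`η ≈ 2–3·ε₁⁺/ε₁⁻`), `t*/WALL = 1/(1 + μ(s*))`
from `0.9831` down to `0.9778`, and the four signs `p > 0`, `⟪c, Dψ₁⟫ < 0`, `⟪u, Dψ₁⟫ > 0`, `⟪Dψ₁, x(s*)⟫ < 0`
hold at 14/14 (table: the seat's PF.md §16.6 / TABLE-G4-SATURATION.md).  AMP PATH SCAN (`a = 1.00`): along the whole resolvent path `E₀(A₀) < s < s*` the AMP vector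
is one-signed with the EDGE as the point of least modulus at every sampled `s` (27 levels from `E₀ + 4e-9` to
`ε₁⁻`), its edge value shrinking like `|s|^{1/2}` to the even ground state's edge value `1.3e-14` and changing
sign exactly once, at `s* = (ε₁⁻ + μ ε₁⁺)/(1 + μ)`.

So the cell's one-signedness question for the even ground state reads, in this language: `u_a` is one-signed iff
the AMP family keeps its sign from the pole-free ground level up to `ε₁⁺(a)`; in the edge channel the first loss
of sign is the unique root of `(ε₁⁻ − s)·p⟪Dψ₁, x(s)⟫ = (ε₁⁺ − s)⟪u, x(s)⟫⟪c, Dψ₁⟫`, which sits at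
`≈ ε₁⁻/(1 + μ_geom)`, a factor `10^{2.4 … 3.8}` ABOVE `ε₁⁺` in the data.  Nothing here proves one-signedness;
the identities locate where it can fail.

References: P. Clément, L. A. Peletier, J. Differential Equations 34 (1979) 218–229 (anti-maximum principle);
J. R. Bunch, C. P. Nielsen, D. C. Sorensen, Numer. Math. 31 (1978) 31–48 (rank-one modification, secular equation);
E. Bombieri, Rend. Mat. Acc. Lincei (9) 11 (2000) 183–233, Thm 2 (the window quadratic form).
-/

set_option linter.dupNamespace false  -- the mandated namespace repeats `RiemannHypothesis`

noncomputable section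

namespace Summit.RiemannHypothesis.RiemannHypothesis.Theorems.PolarPerronFrobenius

open scoped InnerProductSpace

variable {E : Type*} [NormedAddCommGroup E] [InnerProductSpace ℝ E]
variable {F : Type*} [AddCommGroup F] [Module ℝ F]
variable {ι : Type*}

/-! ## §1 Exact identities: secular resolvent identity, even level, off-level pairing -/

section identities

variable {A₀ : E →ₗ[ℝ] E} {c d : E} {β : ℝ} {D : F →ₗ[ℝ] E} {Qm : F →ₗ[ℝ] F} {ρ : F →ₗ[ℝ] ℝ}

/-- **PROVED — RESOLVENT IDENTITY FOR THE SECULAR FUNCTION.** If `A₀` is symmetric and `x₁, x₂` are AMP vectors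
at levels `s₁, s₂` (`A₀xᵢ − sᵢxᵢ = c`), then `⟪c, x₂⟫ − ⟪c, x₁⟫ = (s₂ − s₁)⟪x₁, x₂⟫`; so the secular function
`s ↦ 1 + β⟪c, x(s)⟫` has difference quotients `β⟪x(s₁), x(s₂)⟫`. [folklore] -/
theorem secular_diff (hA : ∀ v w : E, ⟪A₀ v, w⟫_ℝ = ⟪v, A₀ w⟫_ℝ) {s₁ s₂ : ℝ} {x₁ x₂ : E}
    (hx₁ : A₀ x₁ - s₁ • x₁ = c) (hx₂ : A₀ x₂ - s₂ • x₂ = c) :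
    ⟪c, x₂⟫_ℝ - ⟪c, x₁⟫_ℝ = (s₂ - s₁) * ⟪x₁, x₂⟫_ℝ := by
  have h1 : A₀ x₁ = s₁ • x₁ + c := by rw [← hx₁]; abel
  have h2 : A₀ x₂ = s₂ • x₂ + c := by rw [← hx₂]; abel
  have key := hA x₁ x₂
  rw [h1, h2, inner_add_left, inner_add_right, real_inner_smul_left, real_inner_smul_right,
    real_inner_comm c x₁] at key
  linear_combination key

/-- **PROVED — THE EVEN GROUND STATE IS THE AMP VECTOR AT ITS OWN LEVEL.** An even eigenpair of the full block,
`A₀u + β⟪c, u⟫c = ε⁺u`, satisfies `A₀u − ε⁺u = −(β⟪c, u⟫)·c`. [folklore] -/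
theorem ampVector_at_evenLevel {εp : ℝ} {u : E} (hu : A₀ u + β • (⟪c, u⟫_ℝ • c) = εp • u) :
    A₀ u - εp • u = (-(β * ⟪c, u⟫_ℝ)) • c := by
  have h : A₀ u = εp • u - β • (⟪c, u⟫_ℝ • c) := by rw [← hu]; abel
  rw [h, smul_smul, neg_smul]
  abel

/-- **PROVED — THE SECULAR FUNCTION THROUGH THE EVEN OVERLAP.** `A₀` symmetric, `A₀u + β⟪c,u⟫c = ε⁺u`,
`A₀x − s x = c` ⟹ `⟪c, u⟫·(1 + β⟪c, x⟫) = (ε⁺ − s)⟪u, x⟫`.  In particular the secular function vanishes at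
the even level (`s = ε⁺`, `⟪c,u⟫ ≠ 0`) and has the sign of `(s − ε⁺)·(−⟪u, x(s)⟫/⟪c,u⟫)`. [folklore] -/
theorem secular_eq_evenOverlap (hA : ∀ v w : E, ⟪A₀ v, w⟫_ℝ = ⟪v, A₀ w⟫_ℝ) {εp : ℝ} {u : E}
    (hu : A₀ u + β • (⟪c, u⟫_ℝ • c) = εp • u) {s : ℝ} {x : E} (hx : A₀ x - s • x = c) :
    ⟪c, u⟫_ℝ * (1 + β * ⟪c, x⟫_ℝ) = (εp - s) * ⟪u, x⟫_ℝ := by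
  have h1 : A₀ u = εp • u - β • (⟪c, u⟫_ℝ • c) := by rw [← hu]; abel
  have h2 : A₀ x = s • x + c := by rw [← hx]; abel
  have key := hA u x
  rw [h1, h2, inner_sub_left, inner_add_right, real_inner_smul_left, real_inner_smul_right,
    real_inner_smul_left, real_inner_smul_left, real_inner_comm c u] at key
  linear_combination (-1 : ℝ) * key

/-- **PROVED — THE OFF-LEVEL PAIRING IDENTITY.** `A₀` symmetric, (G), `Q⁻ψ = eψ`, and `A₀x − s x = c` at ANY
level `s` ⟹ `2ρ(ψ)⟪δ_a, x⟫ = ⟪c, Dψ⟫(1 + β⟪c, x⟫) + (s − e)⟪Dψ, x⟫`.  (`intertwining_pairing` is `s = e`.)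
[folklore] -/
theorem intertwining_pairing_offlevel (hA : ∀ v w : E, ⟪A₀ v, w⟫_ℝ = ⟪v, A₀ w⟫_ℝ)
    (hG : GalerkinIntertwining A₀ c d β D Qm ρ) {e : ℝ} {ψ : F} (hψ : Qm ψ = e • ψ) {s : ℝ} {x : E}
    (hx : A₀ x - s • x = c) :
    2 * ρ ψ * ⟪d, x⟫_ℝ = ⟪c, D ψ⟫_ℝ * (1 + β * ⟪c, x⟫_ℝ) + (s - e) * ⟪D ψ, x⟫_ℝ := by
  have h := hG ψ
  rw [hψ, map_smul] at h
  have hAx : A₀ x = s • x + c := by rw [← hx]; abel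
  have key : ⟪A₀ (D ψ), x⟫_ℝ = s * ⟪D ψ, x⟫_ℝ + ⟪c, D ψ⟫_ℝ := by
    rw [hA, hAx, inner_add_right, real_inner_smul_right, real_inner_comm c (D ψ)]
  have h2 := congrArg (fun v => ⟪v, x⟫_ℝ) h
  simp only [inner_sub_left, inner_add_left, real_inner_smul_left] at h2
  rw [key] at h2
  linear_combination (-1 : ℝ) * h2

/-! ## §2 The edge-zero law: an edge zero of the AMP family is a weighted mean of the two parity levels -/

/-- **PROVED — THE MASTER IDENTITY FOR THE EDGE VALUE.** `A₀` symmetric, (G), even eigenpair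
`A₀u + β⟪c,u⟫c = ε⁺u` with `p = ⟪c, u⟫`, odd eigenpair `Q⁻ψ = eψ`, AMP vector `A₀x − s x = c`:
`2pρ(ψ)⟪δ_a, x⟫ = (ε⁺ − s)⟪u, x⟫⟪c, Dψ⟫ + p(s − e)⟪Dψ, x⟫`. [folklore] -/
theorem edge_value_master (hA : ∀ v w : E, ⟪A₀ v, w⟫_ℝ = ⟪v, A₀ w⟫_ℝ)
    (hG : GalerkinIntertwining A₀ c d β D Qm ρ) {εp : ℝ} {u : E}
    (hu : A₀ u + β • (⟪c, u⟫_ℝ • c) = εp • u) {e : ℝ} {ψ : F} (hψ : Qm ψ = e • ψ) {s : ℝ} {x : E}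
    (hx : A₀ x - s • x = c) :
    2 * ⟪c, u⟫_ℝ * ρ ψ * ⟪d, x⟫_ℝ
      = (εp - s) * ⟪u, x⟫_ℝ * ⟪c, D ψ⟫_ℝ + ⟪c, u⟫_ℝ * (s - e) * ⟪D ψ, x⟫_ℝ := by
  have h1 := intertwining_pairing_offlevel hA hG hψ hx
  have h2 := secular_eq_evenOverlap hA hu hx
  linear_combination ⟪c, u⟫_ℝ * h1 + ⟪c, D ψ⟫_ℝ * h2

/-- **PROVED — THE EDGE-ZERO LAW (weighted-mean form without division).** Under the hypotheses of
`edge_value_master`, at an EDGE ZERO `⟪δ_a, x(s)⟫ = 0`: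
`(p⟪Dψ, x⟫ − ⟪u, x⟫⟪c, Dψ⟫)·s = p⟪Dψ, x⟫·e − ⟪u, x⟫⟪c, Dψ⟫·ε⁺`. [folklore] -/
theorem edgeZero_balance (hA : ∀ v w : E, ⟪A₀ v, w⟫_ℝ = ⟪v, A₀ w⟫_ℝ)
    (hG : GalerkinIntertwining A₀ c d β D Qm ρ) {εp : ℝ} {u : E}
    (hu : A₀ u + β • (⟪c, u⟫_ℝ • c) = εp • u) {e : ℝ} {ψ : F} (hψ : Qm ψ = e • ψ) {s : ℝ} {x : E}
    (hx : A₀ x - s • x = c) (h0 : ⟪d, x⟫_ℝ = 0) :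
    (⟪c, u⟫_ℝ * ⟪D ψ, x⟫_ℝ - ⟪u, x⟫_ℝ * ⟪c, D ψ⟫_ℝ) * s
      = ⟪c, u⟫_ℝ * ⟪D ψ, x⟫_ℝ * e - ⟪u, x⟫_ℝ * ⟪c, D ψ⟫_ℝ * εp := by
  have h := edge_value_master hA hG hu hψ hx
  rw [h0, mul_zero] at h
  linear_combination (-1 : ℝ) * h

/-- The WEIGHT `μ = −⟪u, x⟫⟪c, Dψ⟫ / (⟪c, u⟫⟪Dψ, x⟫)` of the edge-zero law (a served / macroscopic number:
overlaps of the even ground state, the AMP vector, the polar vector and the derivative of the odd eigenvector).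
[folklore] -/
@[folklore]
def edgeWeight (c : E) (D : F →ₗ[ℝ] E) (u x : E) (ψ : F) : ℝ :=
  -(⟪u, x⟫_ℝ * ⟪c, D ψ⟫_ℝ) / (⟪c, u⟫_ℝ * ⟪D ψ, x⟫_ℝ)

/-- **PROVED — AN EDGE ZERO IS THE μ-WEIGHTED MEAN OF THE PARITY LEVELS**: `(1 + μ)·s = e + μ·ε⁺`
(`⟪c,u⟫⟪Dψ, x⟫ ≠ 0`). [folklore] -/
theorem edgeZero_weightedMean (hA : ∀ v w : E, ⟪A₀ v, w⟫_ℝ = ⟪v, A₀ w⟫_ℝ)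
    (hG : GalerkinIntertwining A₀ c d β D Qm ρ) {εp : ℝ} {u : E}
    (hu : A₀ u + β • (⟪c, u⟫_ℝ • c) = εp • u) {e : ℝ} {ψ : F} (hψ : Qm ψ = e • ψ) {s : ℝ} {x : E}
    (hx : A₀ x - s • x = c) (h0 : ⟪d, x⟫_ℝ = 0) (hX : ⟪c, u⟫_ℝ * ⟪D ψ, x⟫_ℝ ≠ 0) :
    (1 + edgeWeight c D u x ψ) * s = e + edgeWeight c D u x ψ * εp := by
  have h := edgeZero_balance hA hG hu hψ hx h0
  have hp : ⟪c, u⟫_ℝ ≠ 0 := left_ne_zero_of_mul hX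
  have hD : ⟪D ψ, x⟫_ℝ ≠ 0 := right_ne_zero_of_mul hX
  have key : (1 + edgeWeight c D u x ψ) * s - (e + edgeWeight c D u x ψ * εp)
      = ((⟪c, u⟫_ℝ * ⟪D ψ, x⟫_ℝ - ⟪u, x⟫_ℝ * ⟪c, D ψ⟫_ℝ) * s
          - (⟪c, u⟫_ℝ * ⟪D ψ, x⟫_ℝ * e - ⟪u, x⟫_ℝ * ⟪c, D ψ⟫_ℝ * εp)) / (⟪c, u⟫_ℝ * ⟪D ψ, x⟫_ℝ) := by
    unfold edgeWeight
    field_simp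
    ring
  rw [h, sub_self, zero_div] at key
  exact sub_eq_zero.mp key

/-- **PROVED — SATURATION**: at an edge zero, `(1 + μ)(s − ε⁺) = e − ε⁺` and `(1 + μ)(e − s) = μ(e − ε⁺)`.
[folklore] -/
theorem edgeZero_saturation_mul (hA : ∀ v w : E, ⟪A₀ v, w⟫_ℝ = ⟪v, A₀ w⟫_ℝ)
    (hG : GalerkinIntertwining A₀ c d β D Qm ρ) {εp : ℝ} {u : E}
    (hu : A₀ u + β • (⟪c, u⟫_ℝ • c) = εp • u) {e : ℝ} {ψ : F} (hψ : Qm ψ = e • ψ) {s : ℝ} {x : E}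
    (hx : A₀ x - s • x = c) (h0 : ⟪d, x⟫_ℝ = 0) (hX : ⟪c, u⟫_ℝ * ⟪D ψ, x⟫_ℝ ≠ 0) :
    (1 + edgeWeight c D u x ψ) * (s - εp) = e - εp
      ∧ (1 + edgeWeight c D u x ψ) * (e - s) = edgeWeight c D u x ψ * (e - εp) := by
  have h := edgeZero_weightedMean hA hG hu hψ hx h0 hX
  constructor
  · linear_combination h
  · linear_combination (-1 : ℝ) * h

/-- **PROVED — BETWEENNESS.** At an edge zero with `μ > 0` and `ε⁺ < e`: `ε⁺ < s < e` (the edge zero lies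
strictly between the even and the odd level). [folklore] -/
theorem edgeZero_mem_Ioo (hA : ∀ v w : E, ⟪A₀ v, w⟫_ℝ = ⟪v, A₀ w⟫_ℝ)
    (hG : GalerkinIntertwining A₀ c d β D Qm ρ) {εp : ℝ} {u : E}
    (hu : A₀ u + β • (⟪c, u⟫_ℝ • c) = εp • u) {e : ℝ} {ψ : F} (hψ : Qm ψ = e • ψ) {s : ℝ} {x : E}
    (hx : A₀ x - s • x = c) (h0 : ⟪d, x⟫_ℝ = 0) (hX : ⟪c, u⟫_ℝ * ⟪D ψ, x⟫_ℝ ≠ 0)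
    (hμ : 0 < edgeWeight c D u x ψ) (hlt : εp < e) : εp < s ∧ s < e := by
  obtain ⟨h1, h2⟩ := edgeZero_saturation_mul hA hG hu hψ hx h0 hX
  have hpos : 0 < 1 + edgeWeight c D u x ψ := by linarith
  constructor
  · have : 0 < (1 + edgeWeight c D u x ψ) * (s - εp) := by rw [h1]; linarith
    have := (mul_pos_iff_of_pos_left hpos).mp this
    linarith
  · have : 0 < (1 + edgeWeight c D u x ψ) * (e - s) := by rw [h2]; exact mul_pos hμ (by linarith)
    have := (mul_pos_iff_of_pos_left hpos).mp this
    linarith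

/-- **PROVED — THE SATURATION RATIO**: at an edge zero with `μ ≠ −1` and `ε⁺ ≠ e`,
`(s − ε⁺)/(e − ε⁺) = 1/(1 + μ)`. [folklore] -/
theorem edgeZero_saturation (hA : ∀ v w : E, ⟪A₀ v, w⟫_ℝ = ⟪v, A₀ w⟫_ℝ)
    (hG : GalerkinIntertwining A₀ c d β D Qm ρ) {εp : ℝ} {u : E}
    (hu : A₀ u + β • (⟪c, u⟫_ℝ • c) = εp • u) {e : ℝ} {ψ : F} (hψ : Qm ψ = e • ψ) {s : ℝ} {x : E}
    (hx : A₀ x - s • x = c) (h0 : ⟪d, x⟫_ℝ = 0) (hX : ⟪c, u⟫_ℝ * ⟪D ψ, x⟫_ℝ ≠ 0)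
    (hμ : 1 + edgeWeight c D u x ψ ≠ 0) (hne : εp ≠ e) :
    (s - εp) / (e - εp) = 1 / (1 + edgeWeight c D u x ψ) := by
  obtain ⟨h1, _⟩ := edgeZero_saturation_mul hA hG hu hψ hx h0 hX
  have hne' : e - εp ≠ 0 := sub_ne_zero.mpr (Ne.symm hne)
  rw [div_eq_div_iff hne' hμ, one_mul, mul_comm]
  exact h1

/-- **PROVED — THE DEFICIT**: at an edge zero with `μ ≠ −1`, `e − s = μ(e − ε⁺)/(1 + μ)`; relative to the odd
level this is the measured `2 %` (`1 − s*/ε₁⁻ = μ(1 − ε₁⁺/ε₁⁻)/(1 + μ)`). [folklore] -/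
theorem edgeZero_deficit (hA : ∀ v w : E, ⟪A₀ v, w⟫_ℝ = ⟪v, A₀ w⟫_ℝ)
    (hG : GalerkinIntertwining A₀ c d β D Qm ρ) {εp : ℝ} {u : E}
    (hu : A₀ u + β • (⟪c, u⟫_ℝ • c) = εp • u) {e : ℝ} {ψ : F} (hψ : Qm ψ = e • ψ) {s : ℝ} {x : E}
    (hx : A₀ x - s • x = c) (h0 : ⟪d, x⟫_ℝ = 0) (hX : ⟪c, u⟫_ℝ * ⟪D ψ, x⟫_ℝ ≠ 0)
    (hμ : 1 + edgeWeight c D u x ψ ≠ 0) :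
    e - s = edgeWeight c D u x ψ * (e - εp) / (1 + edgeWeight c D u x ψ) := by
  obtain ⟨_, h2⟩ := edgeZero_saturation_mul hA hG hu hψ hx h0 hX
  rw [eq_div_iff hμ, mul_comm]
  exact h2

end identities

/-! ## §3 The AMP margin at an edge-zero threshold, and the geometric value of μ -/

section margin

variable (ev : ι → E → ℝ) (δ p ε₁ E₁ : ℝ)
variable {A₀ : E →ₗ[ℝ] E} {c d : E} {β : ℝ} {D : F →ₗ[ℝ] E} {Qm : F →ₗ[ℝ] F} {ρ : F →ₗ[ℝ] ℝ}

/-- **PROVED — `t* = WALL/(1 + μ)` IN THE EDGE CHANNEL.** If the AMP threshold `s* = ampThreshold …` carries an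
AMP vector `x` (`A₀x − s*x = c`) with vanishing edge value (the first failure of one-signedness is AT THE EDGE),
then with the even eigenpair at `ε₁` and an odd eigenpair at `e`:
`ampMargin = ((e − ε₁)/(E₁ − ε₁)) / (1 + μ)` (`ε₁ ≠ E₁`, `μ ≠ −1`). [folklore] -/
theorem ampMargin_eq_wall_div (hA : ∀ v w : E, ⟪A₀ v, w⟫_ℝ = ⟪v, A₀ w⟫_ℝ)
    (hG : GalerkinIntertwining A₀ c d β D Qm ρ) {u : E}
    (hu : A₀ u + β • (⟪c, u⟫_ℝ • c) = ε₁ • u) {e : ℝ} {ψ : F} (hψ : Qm ψ = e • ψ) {x : E}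
    (hx : A₀ x - ampThreshold A₀ c ev δ p ε₁ E₁ • x = c) (h0 : ⟪d, x⟫_ℝ = 0)
    (hX : ⟪c, u⟫_ℝ * ⟪D ψ, x⟫_ℝ ≠ 0) (hμ : 1 + edgeWeight c D u x ψ ≠ 0) (hE : ε₁ ≠ E₁) :
    ampMargin A₀ c ev δ p ε₁ E₁ = (e - ε₁) / (E₁ - ε₁) / (1 + edgeWeight c D u x ψ) := by
  obtain ⟨h1, _⟩ := edgeZero_saturation_mul hA hG hu hψ hx h0 hX
  have hE' : E₁ - ε₁ ≠ 0 := sub_ne_zero.mpr (Ne.symm hE)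
  unfold ampMargin
  rw [div_div, div_eq_div_iff hE' (mul_ne_zero hE' hμ)]
  linear_combination (E₁ - ε₁) * h1

variable {ev δ p ε₁ E₁}

/-- **PROVED — μ AT THE EVEN LEVEL IS GEOMETRIC.** For the AMP vector at the even level itself, `x = −u/(βp)`
(any nonzero multiple `x = t·u` will do), the weight is `μ_geom = −‖u‖²⟪c, Dψ⟫/(p⟪u, Dψ⟫)`:
no resolvent and no tiny level enters. [folklore] -/
theorem mu_at_evenLevel {u : E} {ψ : F} {t : ℝ} (ht : t ≠ 0) :
    edgeWeight c D u (t • u) ψ = -(⟪u, u⟫_ℝ * ⟪c, D ψ⟫_ℝ) / (⟪c, u⟫_ℝ * ⟪D ψ, u⟫_ℝ) := by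
  unfold edgeWeight
  rw [real_inner_smul_right, real_inner_smul_right]
  by_cases h : ⟪c, u⟫_ℝ * ⟪D ψ, u⟫_ℝ = 0
  · have : ⟪c, u⟫_ℝ * (t * ⟪D ψ, u⟫_ℝ) = 0 := by linear_combination t * h
    rw [this, h, div_zero, div_zero]
  · field_simp

/-- **PROVED — THE SIGN OF `⟪u, Dψ⟫` FROM (G).** For an even eigenpair at `ε⁺` and an odd eigenpair at `e` with
`ε⁺ < e`, `ρ(ψ) < 0` and a positive edge value `⟪δ_a, u⟫ > 0` (a one-signed even ground state oriented
positive): `⟪u, Dψ⟫ > 0`. [folklore] -/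
theorem inner_evenEigen_deriv_pos (hA : ∀ v w : E, ⟪A₀ v, w⟫_ℝ = ⟪v, A₀ w⟫_ℝ)
    (hG : GalerkinIntertwining A₀ c d β D Qm ρ) {εp e : ℝ} {u : E} {ψ : F}
    (hu : A₀ u + β • (⟪c, u⟫_ℝ • c) = εp • u) (hψ : Qm ψ = e • ψ) (hlt : εp < e) (hρ : ρ ψ < 0)
    (hd : 0 < ⟪d, u⟫_ℝ) : 0 < ⟪u, D ψ⟫_ℝ := by
  have h := intertwining_pairing_even_eigen hA hG hψ hu
  have hneg : (εp - e) * ⟪u, D ψ⟫_ℝ < 0 := by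
    rw [h]; exact mul_neg_of_neg_of_pos (by linarith) hd
  have hlt' : εp - e < 0 := by linarith
  rcases lt_or_ge 0 ⟪u, D ψ⟫_ℝ with hgt | hle
  · exact hgt
  · have : 0 ≤ (εp - e) * ⟪u, D ψ⟫_ℝ := mul_nonneg_of_nonpos_of_nonpos hlt'.le hle
    linarith

/-- **PROVED — `μ_geom > 0` FROM THREE SIGNS**: `p = ⟪c,u⟫ > 0`, `⟪c, Dψ⟫ < 0`, `⟪u, Dψ⟫ > 0` (the last one
from `inner_evenEigen_deriv_pos`), `u ≠ 0`. [folklore] -/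
theorem muGeom_pos {u : E} {ψ : F} (hu0 : u ≠ 0) (hp : 0 < ⟪c, u⟫_ℝ) (hc : ⟪c, D ψ⟫_ℝ < 0)
    (hD : 0 < ⟪u, D ψ⟫_ℝ) :
    0 < -(⟪u, u⟫_ℝ * ⟪c, D ψ⟫_ℝ) / (⟪c, u⟫_ℝ * ⟪D ψ, u⟫_ℝ) := by
  have huu : 0 < ⟪u, u⟫_ℝ := real_inner_self_pos.mpr hu0
  rw [real_inner_comm u (D ψ)]
  apply div_pos
  · have : ⟪u, u⟫_ℝ * ⟪c, D ψ⟫_ℝ < 0 := mul_neg_of_pos_of_neg huu hc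
    linarith
  · exact mul_pos hp hD

end margin

end Summit.RiemannHypothesis.RiemannHypothesis.Theorems.PolarPerronFrobenius

end
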